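import Literature.Combinatorics.Sahi2008.Indicators
import Literature.Combinatorics.Sahi2008.Percolation
import Literature.Combinatorics.Sahi2008.CumulationCone
import Literature.Combinatorics.Sahi2008.FKG
import Literature.Combinatorics.Sahi2008.Symmetry

/-!
# Sahi (2008) / Blinovsky: cumulations at `n = 3` for FKG measures (proved), and Sahi's `|X| ≤ 2`
# theorem as a named fact

CITATION HEADER.  Sources: [Sahi2008]: p. 210 (the cumulations `𝒞[X] = {f⁺ | f ∈ 𝒫[X]}`,
`f⁺(T) = Σ_{S ⊆ T} f(S)`, i.e. nonnegative combinations of indicators of PRINCIPAL up-sets `{T | T ⊇ S}`),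
**Thm. 2** (p. 211): "For any `n`-tuple of functions `f₁,…,fₙ` in `𝒞[X]`, and for any product measure `μ` as in
(2) we have `E_n(f₁,…,fₙ) ≥ 0`", **Prop. 15** (p. 222): Conjecture 4 (equivalently, by [Sahi2008] and the
appendix of [LiebSahi2021], Conjecture 5) holds for `|X| ≤ 2` — [LiebSahi2021, p. 3]: "[Sahi2008] proves the
conjecture for the lattice `{0,1} × {0,1}`, and for a certain subclass of positive monotone functions on the
general power set lattice `{0,1}^k` equipped with a product measure"; [Blinovsky2013, Lemma and Appendix] (the
`n = 3` mechanism for FKG measures, formalised in the tree as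
`Literature.Probability.LatticeModels.latticeE3_nonneg_of_principal`).

What is here:
* (`setInd`, the layer cake and the reduction to indicators are in `Sahi2008/Indicators.lean`;)
* `IsLatticeCumulation f` — Sahi's class `𝒞` on a general finite lattice: `f = Σ_c g(c)·1_{x ≥ c}` with `g ≥ 0`
  (on `2^X` exactly `f = g⁺`, the cell's `IsCumulation`);
* PROVED (`n = 3`, any FKG probability weight on a finite distributive lattice): `E_3(1_A, 1_B, 1_{↑c}) ≥ 0` for
  up-sets `A, B` and a principal up-set (`sahiE_three_indicator_nonneg_of_principal`, = the tree's
  `latticeE3_nonneg_of_principal` read through `sahiE_three_indicator_eq_latticeE3`), and by multilinearity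
  `E_3(1_A, 1_B, h) ≥ 0` for a cumulation `h` (`sahiE_three_nonneg_of_isLatticeCumulation`), by the layer cake
  `E_3(f, g, h) ≥ 0` for nonnegative monotone `f, g` and a cumulation `h`
  (`sahiE_three_nonneg_of_monotone_of_isLatticeCumulation`) and the verbatim three-cumulation statement
  (`sahiE_three_nonneg_of_isLatticeCumulation₃`) — Sahi's Theorem 2 at `n = 3` in the sharper one-slot form the printed
  proof gives, for FKG (not only product) measures [Blinovsky2013];
* NAMED FACT (statement level, printed proof, not yet formalised — formalization debt, not a conjecture):
  `SahiTwoPointLatticeTheorem` [Sahi2008, Prop. 15 and p. 212; LiebSahi2021, p. 3] (`|X| ≤ 2`, all FKG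
  measures, all `n`).  Sahi's Theorem 2 itself (product measures, cumulations, ALL `n`) is PROVED in the tree
  by the cell's `Literature.Combinatorics.Sahi2008.sahi2008_thm2` (`CumulationCone.lean`), whose Boolean-lattice
  cone `IsCumulation` is the case `α = Finset ι` of `IsLatticeCumulation` here
  (`isLatticeCumulation_of_isCumulation`).
-/

noncomputable section

namespace Literature.Combinatorics.Sahi2008

open Finset Function
open Literature.Probability.LatticeModels (mass mass_univ principalUp mem_principalUp isUpperSet_principalUp
  latticeE3 latticeE3_nonneg_of_principal sum_mul_indicator_eq_mass)

variable {α : Type*}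

/-! ### `E(1_A)` -/

/-- `E(χ_A) = μ(A)` (Blinovsky: `⟨f_1⋯f_n⟩_μ = μ(⋂ A_i)` for indicator functions). [cite: Blinovsky2013, p. 1 (notation ⟨f⟩_μ, E_δ = μ(⋂ A_i))] -/
theorem ex_setInd [Fintype α] [DecidableEq α] (μ : α → ℝ) (A : Finset α) : ex μ (setInd A) = mass μ A :=
  sum_mul_indicator_eq_mass μ A

variable [Fintype α]

/-! ### `E_3` on indicators is the tree's `latticeE3` (probability weight) -/

/-- For a probability weight (`∑ μ = 1`), `E_3(1_A, 1_B, 1_C)` equals the tree's homogeneous functional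
`latticeE3 μ A B C` (`= Z³·E₃` with `Z = 1`). [cite: LiebSahi2021, eq. (2.1); Blinovsky2013, Appendix] -/
theorem sahiE_three_indicator_eq_latticeE3 [DecidableEq α] {μ : α → ℝ} (hμ : ∑ x, μ x = 1)
    (A B C : Finset α) : sahiE μ 3 ![setInd A, setInd B, setInd C] = latticeE3 μ A B C := by
  rw [sahiE_three]
  simp only [setInd_mul, ex_setInd]
  unfold latticeE3
  rw [mass_univ, hμ]
  ring

/-- **Sahi's Theorem 2 / Blinovsky, `n = 3`, one principal slot (PROVED):** for an FKG probability weight on a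
finite distributive lattice, up-sets `A, B` and any `c`, `0 ≤ E_3(1_A, 1_B, 1_{{x | c ≤ x}})`.
[cite: Sahi2008, Thm. 2 (p. 211), case n = 3; Blinovsky2013, Lemma and Appendix (arXiv text pp. 1, 3)] -/
theorem sahiE_three_indicator_nonneg_of_principal [DistribLattice α] [DecidableEq α] [DecidableLE α]
    {μ : α → ℝ} (hμ : IsFKGMeasure μ) {A B : Finset α} (hA : IsUpperSet (A : Set α))
    (hB : IsUpperSet (B : Set α)) (c : α) :
    0 ≤ sahiE μ 3 ![setInd A, setInd B, setInd (principalUp c)] := by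
  rw [sahiE_three_indicator_eq_latticeE3 hμ.sum_eq_one]
  exact latticeE3_nonneg_of_principal hμ.nonneg hμ.mul_le_mul hA hB c

/-! ### Cumulations -/

/-- **Sahi's class `𝒞` of cumulations**: `f` is a nonnegative combination of indicators of principal up-sets,
`f(x) = Σ_c g(c)·[c ≤ x]` with `g ≥ 0` (on `2^X`: `f = g⁺`, `g⁺(T) = Σ_{S ⊆ T} g(S)`; `𝒞 ⊆` increasing `⊆`
nonnegative). [cite: Sahi2008, p. 210 (the class 𝒞[X]); Blinovsky2013, p. 1 (unimodal functions)] -/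
def IsLatticeCumulation [Preorder α] [DecidableLE α] (f : α → ℝ) : Prop :=
  ∃ g : α → ℝ, (∀ c, 0 ≤ g c) ∧ f = fun x => ∑ c, if c ≤ x then g c else 0

/-- On the Boolean lattice `Finset ι` the cell's cone `IsCumulation` (`c⁺(T) = Σ_{S ⊆ T} c(S)`,
`CumulationCone.lean`) is contained in `IsLatticeCumulation` (same cone, written with `S ≤ T`).
[cite: Sahi2008, eq. (1) and p. 210 (the class 𝒞[X])] -/
theorem isLatticeCumulation_of_isCumulation {ι : Type*} [DecidableEq ι] [Fintype ι] [DecidableLE (Finset ι)]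
    {g : Finset ι → ℝ}
    (hg : IsCumulation g) : IsLatticeCumulation g := by
  obtain ⟨c, hc, hgc⟩ := hg
  refine ⟨c, hc, funext fun T => ?_⟩
  rw [hgc T, ← Finset.sum_filter]
  congr 1
  ext S
  simp

/-- A cumulation is the weighted sum of principal indicators, as functions. [cite: Sahi2008, p. 210] -/
theorem eq_sum_smul_setInd_of_isLatticeCumulation [Preorder α] [DecidableEq α] [DecidableLE α] {f : α → ℝ}
    {g : α → ℝ} (hf : f = fun x => ∑ c, if c ≤ x then g c else 0) :
    f = ∑ c, g c • setInd (principalUp c) := by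
  rw [hf]
  funext x
  simp only [Finset.sum_apply, Pi.smul_apply, smul_eq_mul, setInd_apply, mem_principalUp, mul_ite, mul_one,
    mul_zero]

/-- Linearity of `E_n` in a slot over a finite sum. [cite: Sahi2008, p. 211 (multilinearity)] -/
theorem sahiE_update_sum_smul (μ : α → ℝ) {n : ℕ} (f : Fin n → α → ℝ) (i : Fin n) {ι : Type*}
    (s : Finset ι) (a : ι → ℝ) (φ : ι → α → ℝ) :
    sahiE μ n (update f i (∑ c ∈ s, a c • φ c)) = ∑ c ∈ s, a c * sahiE μ n (update f i (φ c)) := by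
  classical
  induction s using Finset.induction_on with
  | empty => simp [sahiE_update_zero]
  | insert c s hc ih =>
    rw [Finset.sum_insert hc, Finset.sum_insert hc, ← ih]
    have h := sahiE_update_lin μ n f i (a c) 1 (φ c) (∑ c ∈ s, a c • φ c)
    rw [one_smul, one_mul] at h
    exact h

/-- **Sahi's Theorem 2 / Blinovsky at `n = 3`, cumulation in one slot (PROVED):** for an FKG probability weight
on a finite distributive lattice, up-sets `A, B` and a cumulation `h`, `0 ≤ E_3(1_A, 1_B, h)`.  (By symmetry of
`E_3`, `Sahi2008/Symmetry.lean`, the cumulation may sit in any slot; with all three slots cumulations this is the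
printed statement at `n = 3`.) [cite: Sahi2008, Thm. 2 (p. 211), case n = 3; Blinovsky2013, Lemma and Appendix] -/
theorem sahiE_three_nonneg_of_isLatticeCumulation [DistribLattice α] [DecidableEq α] [DecidableLE α]
    {μ : α → ℝ} (hμ : IsFKGMeasure μ) {A B : Finset α} (hA : IsUpperSet (A : Set α))
    (hB : IsUpperSet (B : Set α)) {h : α → ℝ} (hh : IsLatticeCumulation h) :
    0 ≤ sahiE μ 3 ![setInd A, setInd B, h] := by
  obtain ⟨g, hg, hfg⟩ := hh
  have hupd : ∀ φ : α → ℝ, (![setInd A, setInd B, φ] : Fin 3 → α → ℝ) = update ![setInd A, setInd B, 0] 2 φ := by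
    intro φ
    funext i
    fin_cases i <;> simp
  rw [eq_sum_smul_setInd_of_isLatticeCumulation hfg, hupd, sahiE_update_sum_smul]
  refine Finset.sum_nonneg fun c _ => mul_nonneg (hg c) ?_
  rw [← hupd]
  exact sahiE_three_indicator_nonneg_of_principal hμ hA hB c

/-- **Sahi's Theorem 2 / Blinovsky at `n = 3`, sharp one-slot form (PROVED):** for an FKG probability weight on
a finite distributive lattice, nonnegative monotone `f, g` and a cumulation `h`, `0 ≤ E_3(f, g, h)` — layer cake in
the first two slots (`Sahi2008/Indicators.lean`) reduces to up-set indicators, then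
`sahiE_three_nonneg_of_isLatticeCumulation`.  In particular `E_3 ≥ 0` for three cumulations, the printed statement at
`n = 3`. [cite: Sahi2008, Thm. 2 (p. 211), case n = 3; Blinovsky2013, Lemma and Appendix; LiebSahi2021, Lemma 2.2] -/
theorem sahiE_three_nonneg_of_monotone_of_isLatticeCumulation [DistribLattice α] [DecidableEq α] [DecidableLE α]
    {μ : α → ℝ} (hμ : IsFKGMeasure μ) {f g h : α → ℝ} (hf : ∀ x, 0 ≤ f x) (hfm : Monotone f)
    (hg : ∀ x, 0 ≤ g x) (hgm : Monotone g) (hh : IsLatticeCumulation h) :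
    0 ≤ sahiE μ 3 ![f, g, h] := by
  obtain ⟨lf, hlf, hflf⟩ := exists_upperSet_decomposition f hf hfm
  obtain ⟨lg, hlg, hglg⟩ := exists_upperSet_decomposition g hg hgm
  -- slot 0
  have h0 : ∀ φ : α → ℝ, (![φ, g, h] : Fin 3 → α → ℝ) = update ![0, g, h] 0 φ := by
    intro φ; funext i; fin_cases i <;> simp
  rw [h0, hflf, sahiE_update_listSum]
  refine List.sum_nonneg fun t ht => ?_
  obtain ⟨pf, hpf, rfl⟩ := List.mem_map.1 ht
  refine mul_nonneg (hlf pf hpf).1 ?_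
  rw [← h0]
  -- slot 1
  have h1 : ∀ ψ : α → ℝ, (![setInd pf.2, ψ, h] : Fin 3 → α → ℝ) = update ![setInd pf.2, 0, h] 1 ψ := by
    intro ψ; funext i; fin_cases i <;> simp
  rw [h1, hglg, sahiE_update_listSum]
  refine List.sum_nonneg fun t' ht' => ?_
  obtain ⟨pg, hpg, rfl⟩ := List.mem_map.1 ht'
  refine mul_nonneg (hlg pg hpg).1 ?_
  rw [← h1]
  exact sahiE_three_nonneg_of_isLatticeCumulation hμ (hlf pf hpf).2 (hlg pg hpg).2 hh

/-- **Sahi's Theorem 2 at `n = 3`, verbatim form (three cumulations), for FKG measures** [Blinovsky2013] (PROVED).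
[cite: Sahi2008, Thm. 2 (p. 211), case n = 3; Blinovsky2013, Lemma and Appendix] -/
theorem sahiE_three_nonneg_of_isLatticeCumulation₃ [DistribLattice α] [DecidableEq α] [DecidableLE α]
    {μ : α → ℝ} (hμ : IsFKGMeasure μ) {f g h : α → ℝ} (hf : IsLatticeCumulation f) (hg : IsLatticeCumulation g)
    (hh : IsLatticeCumulation h) : 0 ≤ sahiE μ 3 ![f, g, h] := by
  have hnn : ∀ {k : α → ℝ}, IsLatticeCumulation k → ∀ x, 0 ≤ k x := by
    intro k hk x
    obtain ⟨c, hc, rfl⟩ := hk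
    exact Finset.sum_nonneg fun y _ => by split_ifs <;> [exact hc y; exact le_rfl]
  have hmono : ∀ {k : α → ℝ}, IsLatticeCumulation k → Monotone k := by
    intro k hk x y hxy
    obtain ⟨c, hc, rfl⟩ := hk
    refine Finset.sum_le_sum fun z _ => ?_
    by_cases hz : z ≤ x
    · rw [if_pos hz, if_pos (le_trans hz hxy)]
    · rw [if_neg hz]
      split_ifs <;> [exact hc z; exact le_rfl]
  exact sahiE_three_nonneg_of_monotone_of_isLatticeCumulation hμ (hnn hf) (hmono hf) (hnn hg) (hmono hg) hh

/-! ### The printed theorems beyond what is formalised: named facts (statement level) -/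

/-- **Sahi 2008, Proposition 15** (named fact, printed proof; formalization debt): on `2^X` with `|X| ≤ 2`,
every FKG probability weight is Sahi-positive of every order — Lieb–Sahi (p. 3): Sahi 2008 "proves [the `n`-function
inequality] for the lattice `{0,1} × {0,1}`"; the passage from the power-series form proved in Prop. 15 to `E_n ≥ 0`
is Sahi's own implication, restated as [LiebSahi2021, Thm. 4.4].
[cite: Sahi2008, Prop. 15 (p. 222); LiebSahi2021, p. 3 and Thm. 4.4] -/
def SahiTwoPointLatticeTheorem : Prop :=
  ∀ (X : Type) [Fintype X], Fintype.card X ≤ 2 →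
    ∀ μ : Set X → ℝ, IsFKGMeasure μ → ∀ n : ℕ, SahiPositive μ n

/-! ### Discharge of `SahiTwoPointLatticeTheorem` (Sahi 2008, Prop. 15): `|X| ≤ 2`, every FKG weight, every `n`

The printed proof [Sahi2008, pp. 222–226] is a computation with formal power series: Lemma 14 writes an
increasing `F` on `2^{{1,2}}` as `F(∅) = a`, `F({1}) = a+b+c`, `F({2}) = a+b+d`, `F(X) = a+b+c+d+e` with
`a,…,e ∈ 𝒫`, and Lemma 16 shows that `1 − (1−a)^δ (1−a−b−c)^γ (1−a−b−d)^β (1−a−b−c−d−e)^α` has nonnegative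
coefficients when `α+β+γ+δ = 1`, `αδ ≥ βγ`, the last step being the inequality `α ≥ (α+γ)(α+β)`; Conjecture 5
(`E_n ≥ 0`) then follows from Conjecture 4 by [Sahi2008, Prop. 12] / [LiebSahi2021, Thm. 4.4].
DOCUMENTED DEVIATION: the formal proof below reaches the printed conclusion `E_n ≥ 0` by an elementary argument
in the recursion vocabulary of this directory instead of power series (the square-free generating-function
machinery of `CumulationCone.lean` is private to that file).  (i) Layer cake (`sahiPositive_iff_indicators`):
it suffices to treat `n`-tuples of indicators of up-sets.  (ii) PEEL STEP (`sahiE_cons_nonneg_of_absorbed`, one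
application of the Lieb–Sahi recursion [LiebSahi2021, Prop. 3.3]): if the head `h` has `E(h) ≤ 1`, some tail slot
is absorbed by it (`g_{i₀}·h = g_{i₀}`, i.e. `U_{i₀} ⊆ U_head`), and all the `(n−1)`-families occurring in the
recursion have `E_{n−1} ≥ 0`, then `E_n(h, g) ≥ Σ_i E_{n−1}(…) − E_{n−1}(g) ≥ E_{n−1}(g)(1 − E(h)) ≥ 0`.
(iii) On the lattice `2^X`, `|X| = 2`, the up-sets are `∅ ⊂ {X} ⊂ ↑{1}, ↑{2} ⊂ ↑{1} ∪ ↑{2} ⊂ 2^X`, a family in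
which among any THREE up-sets two are nested; we prove this for every finite preorder that is a chain after
deleting one point (`2^{{1,2}}` minus `{1}` is the chain `∅ ⊂ {2} ⊂ X`): two of three up-sets agree on the deleted
point and are then nested.  Hence for `n ≥ 3` a peel step with an absorbed slot is always available (after a
permutation of the slots, `sahiE_comp_perm`), and the induction bottoms out at `n = 2`, which is the FKG
inequality (`sahiPositive_two`) — the only place where the lattice condition `αδ ≥ βγ` enters, exactly as
`α ≥ (α+γ)(α+β)` is the only place it enters the printed proof (p. 226).  The mechanism is recorded for the class
"finite distributive lattice, chain off one point" (`sahiPositive_of_isChain_ne`), which contains Sahi's `2^X`,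
`|X| ≤ 2`, and nothing is claimed in print beyond `|X| ≤ 2`. -/

section TwoPoint

/-- **Peel step** (one application of the Lieb–Sahi recursion `E_{m+2}(h, g) = Σ_i E_{m+1}(g_0,…,g_i h,…,g_m)
− E_{m+1}(g)·E(h)` [LiebSahi2021, Prop. 3.3]): if `E(h) ≤ 1`, some tail slot is absorbed by the head
(`g_{i₀}·h = g_{i₀}`), `E_{m+1}(g) ≥ 0` and every modified tail has `E_{m+1} ≥ 0`, then `E_{m+2}(h, g) ≥ 0`
(indeed `≥ E_{m+1}(g)(1 − E(h))`). [cite: LiebSahi2021, Prop. 3.3] -/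
theorem sahiE_cons_nonneg_of_absorbed {μ : α → ℝ} {h : α → ℝ} (hh : ex μ h ≤ 1) {m : ℕ}
    {g : Fin (m + 1) → α → ℝ} (habs : ∃ i₀, g i₀ * h = g i₀) (hg : 0 ≤ sahiE μ (m + 1) g)
    (hupd : ∀ i, 0 ≤ sahiE μ (m + 1) (update g i (g i * h))) :
    0 ≤ sahiE μ (m + 2) (Matrix.vecCons h g) := by
  obtain ⟨i₀, hi₀⟩ := habs
  rw [sahiE_cons]
  have h1 : sahiE μ (m + 1) g ≤ ∑ i, sahiE μ (m + 1) (update g i (g i * h)) := by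
    calc sahiE μ (m + 1) g = sahiE μ (m + 1) (update g i₀ (g i₀ * h)) := by rw [hi₀, update_eq_self]
      _ ≤ ∑ i, sahiE μ (m + 1) (update g i (g i * h)) :=
        Finset.single_le_sum (f := fun i => sahiE μ (m + 1) (update g i (g i * h)))
          (fun i _ => hupd i) (Finset.mem_univ i₀)
  have h2 : sahiE μ (m + 1) g * ex μ h ≤ sahiE μ (m + 1) g := by
    calc sahiE μ (m + 1) g * ex μ h ≤ sahiE μ (m + 1) g * 1 := mul_le_mul_of_nonneg_left hh hg
      _ = sahiE μ (m + 1) g := mul_one _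
  linarith

omit [Fintype α] in
/-- In a preorder that is a chain after deleting the point `a`, two up-sets that agree on `a` are nested
(plumbing for `exists_nested_of_three`). [folklore] -/
private theorem upperSet_nested_of_agree [Preorder α] {a : α} (hC : IsChain (· ≤ ·) {x : α | x ≠ a})
    {U V : Finset α} (hU : IsUpperSet (U : Set α)) (hV : IsUpperSet (V : Set α))
    (haUV : a ∈ U ↔ a ∈ V) : U ⊆ V ∨ V ⊆ U := by
  by_contra hcon
  obtain ⟨hUV, hVU⟩ := not_or.1 hcon
  obtain ⟨x, hxU, hxV⟩ := Finset.not_subset.1 hUV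
  obtain ⟨y, hyV, hyU⟩ := Finset.not_subset.1 hVU
  have hxa : x ≠ a := by
    rintro rfl
    exact hxV (haUV.1 hxU)
  have hya : y ≠ a := by
    rintro rfl
    exact hyU (haUV.2 hyV)
  have hxy : x ≠ y := by
    rintro rfl
    exact hxV hyV
  rcases hC hxa hya hxy with hle | hle
  · exact hyU (hU hle hxU)
  · exact hxV (hV hle hyV)

omit [Fintype α] in
/-- Among three up-sets of a preorder that is a chain after deleting one point, two are nested: two of them
agree on the deleted point (plumbing for the induction below). [folklore] -/
private theorem exists_nested_of_three [Preorder α] {a : α} (hC : IsChain (· ≤ ·) {x : α | x ≠ a})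
    (U : Fin 3 → Finset α) (hU : ∀ k, IsUpperSet ((U k : Finset α) : Set α)) :
    ∃ i j : Fin 3, i ≠ j ∧ U j ⊆ U i := by
  have key : ∀ k l : Fin 3, k ≠ l → (a ∈ U k ↔ a ∈ U l) → ∃ i j : Fin 3, i ≠ j ∧ U j ⊆ U i := by
    intro k l hkl hag
    rcases upperSet_nested_of_agree hC (hU k) (hU l) hag with h | h
    · exact ⟨l, k, hkl.symm, h⟩
    · exact ⟨k, l, hkl, h⟩
  by_cases h0 : a ∈ U 0
  · by_cases h1 : a ∈ U 1
    · exact key 0 1 (by decide) (iff_of_true h0 h1)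
    · by_cases h2 : a ∈ U 2
      · exact key 0 2 (by decide) (iff_of_true h0 h2)
      · exact key 1 2 (by decide) (iff_of_false h1 h2)
  · by_cases h1 : a ∈ U 1
    · by_cases h2 : a ∈ U 2
      · exact key 1 2 (by decide) (iff_of_true h1 h2)
      · exact key 0 2 (by decide) (iff_of_false h0 h2)
    · exact key 0 1 (by decide) (iff_of_false h0 h1)

omit [Fintype α] in
/-- Replacing one set of a family by its intersection with `W` multiplies the corresponding indicator slot by
`χ_W` (plumbing). [folklore] -/
private theorem setInd_update_inter [DecidableEq α] {m : ℕ} (V : Fin m → Finset α) (k : Fin m)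
    (W : Finset α) :
    (fun k' => setInd (update V k (V k ∩ W) k')) =
      update (fun k' => setInd (V k')) k (setInd (V k) * setInd W) := by
  funext k'
  by_cases hk : k' = k
  · subst hk
    simp only [update_self, setInd_mul]
  · simp only [update_of_ne hk]

/-- The induction behind Prop. 15: on a finite distributive lattice that is a chain after deleting one point,
`E_{m+2}(χ_{U_0},…,χ_{U_{m+1}}) ≥ 0` for every family of up-sets and every FKG probability weight — `m = 0` is
the FKG inequality, and for `m + 1` two of the first three sets are nested, giving a peel step with an absorbed
slot (plumbing; the public statement is `sahiPositive_of_isChain_ne`). [folklore] -/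
private theorem sahiE_setInd_nonneg_of_isChain_ne [DistribLattice α] [DecidableEq α] {μ : α → ℝ}
    (hμ : IsFKGMeasure μ) {a : α} (hC : IsChain (· ≤ ·) {x : α | x ≠ a}) :
    ∀ (m : ℕ) (U : Fin (m + 2) → Finset α), (∀ i, IsUpperSet ((U i : Finset α) : Set α)) →
      0 ≤ sahiE μ (m + 2) (fun i => setInd (U i)) := by
  intro m
  induction m with
  | zero =>
    intro U hU
    exact sahiPositive_two hμ _ (fun i x => setInd_nonneg _ _) (fun i => monotone_setInd (hU i))
  | succ m ih =>
    intro U hU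
    -- two of the first three sets are nested: `U j' ⊆ U i'`
    have h3 : 3 ≤ m + 1 + 2 := by omega
    obtain ⟨i, j, hij, hji⟩ :=
      exists_nested_of_three hC (fun k => U (Fin.castLE h3 k)) (fun k => hU _)
    obtain ⟨i', hi'⟩ : ∃ i' : Fin (m + 1 + 2), i' = Fin.castLE h3 i := ⟨_, rfl⟩
    obtain ⟨j', hj'⟩ : ∃ j' : Fin (m + 1 + 2), j' = Fin.castLE h3 j := ⟨_, rfl⟩
    have hij' : i' ≠ j' := by
      rw [hi', hj']
      exact fun h => hij (Fin.castLE_injective h3 h)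
    have hsub : U j' ⊆ U i' := by
      rw [hi', hj']
      exact hji
    -- move slot `i'` to the front
    obtain ⟨σ, hσ⟩ : ∃ σ : Equiv.Perm (Fin (m + 1 + 2)), σ = Equiv.swap 0 i' := ⟨_, rfl⟩
    have hσ0 : σ 0 = i' := by
      rw [hσ, Equiv.swap_apply_left]
    have hfam : (fun k => setInd (U (σ k))) =
        Matrix.vecCons (setInd (U i')) (fun k => setInd (U (σ k.succ))) := by
      funext k
      refine Fin.cases ?_ (fun k' => ?_) k
      · simp only [Matrix.cons_val_zero, hσ0]
      · simp only [Matrix.cons_val_succ]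
    have e1 : sahiE μ (m + 1 + 2) (fun i => setInd (U i)) =
        sahiE μ (m + 1 + 2) (Matrix.vecCons (setInd (U i')) (fun k => setInd (U (σ k.succ)))) := by
      rw [← hfam]
      exact (sahiE_comp_perm μ (m + 1 + 2) σ (fun i => setInd (U i))).symm
    rw [e1]
    refine sahiE_cons_nonneg_of_absorbed ?_ ?_ ?_ ?_
    · -- `E(χ_{U i'}) ≤ 1`
      calc ex μ (setInd (U i')) ≤ ex μ (fun _ => (1 : ℝ)) :=
            ex_mono hμ.nonneg fun x => by
              rw [setInd_apply]
              split_ifs <;> norm_num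
        _ = 1 := ex_const hμ.sum_eq_one 1
    · -- the absorbed slot: the tail position of `j'`
      have hj0 : σ.symm j' ≠ 0 := by
        intro h0
        apply hij'
        rw [← hσ0, ← h0, Equiv.apply_symm_apply]
      obtain ⟨k₀, hk₀⟩ := Fin.exists_succ_eq.2 hj0
      refine ⟨k₀, ?_⟩
      have hσk : σ k₀.succ = j' := by
        rw [hk₀, Equiv.apply_symm_apply]
      show setInd (U (σ k₀.succ)) * setInd (U i') = setInd (U (σ k₀.succ))
      rw [hσk, setInd_mul, Finset.inter_eq_left.2 hsub]
    · -- the unmodified tail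
      exact ih (fun k => U (σ k.succ)) fun k => hU _
    · -- the modified tails: one up-set replaced by its intersection with `U i'`
      intro k
      show 0 ≤ sahiE μ (m + 1 + 1)
        (update (fun k' => setInd (U (σ k'.succ))) k (setInd (U (σ k.succ)) * setInd (U i')))
      rw [← setInd_update_inter (fun k' => U (σ k'.succ)) k (U i')]
      refine ih _ fun k' => ?_
      by_cases hk : k' = k
      · subst hk
        rw [update_self, Finset.coe_inter]
        exact (hU _).inter (hU _)
      · rw [update_of_ne hk]
        exact hU _

/-- **Sahi positivity of every order on a "chain plus one point" FKG poset.**  If a finite distributive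
lattice `α` is a chain after deleting one point `a` and `μ` is an FKG probability weight on `α`, then
`E_n(f_0,…,f_{n−1}) ≥ 0` for every `n` and all nonnegative monotone `f_i`.  The case `α = 2^X`, `|X| ≤ 2`
(`2^{{1,2}}` minus `{1}` is the chain `∅ ⊂ {2} ⊂ X`) is Sahi's Proposition 15 (`SahiTwoPointLatticeTheorem_holds`
below); nothing beyond `|X| ≤ 2` is claimed in print — this is the mechanism of the formal proof (layer cake,
peel steps with an absorbed slot, FKG at `n = 2`; see the section docstring for the documented deviation from
the printed power-series proof). [cite: Sahi2008, Prop. 15 (p. 222), the case α = 2^X with |X| ≤ 2;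
LiebSahi2021, Prop. 3.3 (the recursion used)] -/
theorem sahiPositive_of_isChain_ne [DistribLattice α] [DecidableEq α] {μ : α → ℝ} (hμ : IsFKGMeasure μ)
    {a : α} (hC : IsChain (· ≤ ·) {x : α | x ≠ a}) (n : ℕ) : SahiPositive μ n := by
  match n with
  | 0 => exact sahiPositive_zero μ
  | 1 => exact sahiPositive_one hμ.nonneg
  | m + 2 =>
    rw [sahiPositive_iff_indicators]
    exact sahiE_setInd_nonneg_of_isChain_ne hμ hC m

/-- The power-set lattice of a type with at most two elements is a chain after deleting one point: for
`X = {x, y}` delete `{x}`, leaving `∅ ⊂ {y} ⊂ X`; for `|X| ≤ 1` the whole lattice is a chain (plumbing for the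
discharge). [folklore] -/
private theorem set_isChain_ne_of_card_le_two (X : Type*) [Fintype X] (hX : Fintype.card X ≤ 2) :
    ∃ a : Set X, IsChain (· ≤ ·) {S : Set X | S ≠ a} := by
  classical
  by_cases hle : Fintype.card X ≤ 1
  · -- every set is `∅` or everything: the whole lattice is a chain
    have h1 : ∀ x y : X, x = y := Fintype.card_le_one_iff.1 hle
    refine ⟨∅, fun S _ T _ _ => ?_⟩
    by_cases hT : ∃ x, x ∈ T
    · obtain ⟨x, hx⟩ := hT
      exact Or.inl fun y _ => (h1 y x) ▸ hx
    · exact Or.inr fun y hy => (hT ⟨y, hy⟩).elim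
  · -- exactly two elements `x ≠ y`
    have h2 : (Finset.univ : Finset X).card = 2 := by
      rw [Finset.card_univ]
      omega
    obtain ⟨x, y, hxy, huniv⟩ := Finset.card_eq_two.1 h2
    have hall : ∀ z : X, z = x ∨ z = y := fun z => by
      have hz := Finset.mem_univ z
      rw [huniv, Finset.mem_insert, Finset.mem_singleton] at hz
      exact hz
    -- a set other than `{x}` that contains `x` also contains `y`
    have key : ∀ R : Set X, R ≠ {x} → x ∈ R → y ∈ R := by
      intro R hR hxR
      by_contra hyR
      apply hR
      ext z
      rw [Set.mem_singleton_iff]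
      constructor
      · intro hz
        rcases hall z with rfl | rfl
        · rfl
        · exact (hyR hz).elim
      · rintro rfl
        exact hxR
    refine ⟨{x}, fun S hS T hT _ => ?_⟩
    by_cases hxS : x ∈ S
    · -- `S = X`
      refine Or.inr fun z _ => ?_
      rcases hall z with rfl | rfl
      · exact hxS
      · exact key S hS hxS
    · by_cases hxT : x ∈ T
      · -- `T = X`
        refine Or.inl fun z _ => ?_
        rcases hall z with rfl | rfl
        · exact hxT
        · exact key T hT hxT
      · -- `S, T ⊆ {y}`
        by_cases hyT : y ∈ T
        · refine Or.inl fun z hz => ?_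
          rcases hall z with rfl | rfl
          · exact (hxS hz).elim
          · exact hyT
        · refine Or.inr fun z hz => ?_
          rcases hall z with rfl | rfl
          · exact (hxT hz).elim
          · exact (hyT hz).elim

/-- **Sahi 2008, Proposition 15 — discharged**: on `2^X` with `|X| ≤ 2`, every FKG probability weight is
Sahi-positive of every order `n` (Lieb–Sahi: Sahi "proves the conjecture for the lattice `{0,1} × {0,1}`").
Formal proof: `sahiPositive_of_isChain_ne` (the power set of `{x, y}` minus `{x}` is the chain `∅ ⊂ {y} ⊂ X`);
see the section docstring for how it relates to the printed power-series proof.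
[cite: Sahi2008, Prop. 15 (p. 222); LiebSahi2021, p. 3 and Thm. 4.4] -/
theorem SahiTwoPointLatticeTheorem_holds : SahiTwoPointLatticeTheorem := by
  intro X _ hX μ hμ n
  classical
  obtain ⟨a, ha⟩ := set_isChain_ne_of_card_le_two X hX
  exact sahiPositive_of_isChain_ne hμ ha n

end TwoPoint

end Literature.Combinatorics.Sahi2008
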